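import Summits.QuantumFields.YangMills.Theorems.BalabanUVNodesN19AgeCutRoad
import Summits.QuantumFields.YangMills.Theorems.BalabanUVNodesN19FibreAveragingGain
import Summits.QuantumFields.YangMills.Theorems.BalabanUVNodesN19HybridBeyondTarget

/-!
# BalabanUVNodes ∕ node N19 (NE7) — AN A2 INHABITANT OF BOTH AGE ROADS: the three letters (age map, activity as weight fraction, birth-scale matching) are JOINTLY and
# NON-DEGENERATELY satisfiable, with Bałaban's own activity shape, and both typed roads FIRE on one datum (fine key + half-age cut ⇒ `HybridNE7`; collapse key ⇒ the totals'
# core edge)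

Cell `pub-ymgap` (HUMAN RULING D-0062 Track A ∕ D-0149 width seats), WIDTH SEAT `pub-ymgap-dag-n19-w1` (node n19 = NE7, seat 1 of 3), generation g3,
INTENT-8 (hygiene №189 A6: a displayed hypothesis list gets a non-degenerate inhabitant).  Route `Summits/QuantumFields/YangMills/Theses/BalabanUVNodes.lean`, key item K3⁷
`SpineGivenEndpointR13SepCoPH` (stmt-QuantumFields-20544); filed `--kind proof --supports … --as helper`.  COUNT-NEUTRAL.  THEOREMS ONLY (0 `def`, 0 `sorry`).  ADDITIVE — imports this seat's g3
`…N19AgeCutRoad` (p605203: `hybridNE7_halfAgeCut_eventually`), `…N19FibreAveragingGain` (p604890: `coreEdge_classVal_of_ageActivity`; through it `…N19AgeScaleTransportBudget` p603780: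
`summable_succ_pow_mul_balabanActivity`) and `…N19HybridBeyondTarget` (p602850: `not_coreEdge_of_unsummable_gap`) ONLY; modifies nothing.

THE DATUM (a caricature of the old-large-field channel, NOT Bałaban's objects).  Index = the AGE itself: at level `K` the classes are `n ∈ range (K+1)` («the oldest healed large-field
component of the term has age `n`», `0` = none), `age K t n = n`; run A's weight of class `n` is the activity `a n` with `a 0 = 1` (the component-free bulk) and `a n > 0`; run B's is
`a n · e^{−u (K − n)}` — the two runs DIFFER on an age-`n` class exactly by the birth-scale letter `u (K − n)`, `u` non-negative, ANTITONE, `u j ≤ C·θ^j`.  Then every hypothesis of both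
roads holds (§1): positivity; `age ≤ K`; `|log B − log A − 0| = u(K − n)`; the age-`n` weight FRACTION is `≤ a n` in run A because the bulk weighs `a 0 = 1`, and in run B because moreover
`u` is antitone (`e^{−u(K−n)} ≤ e^{−u(K)}` = the bulk's factor); the worst case is `R = u 0 ≤ C`.  Non-degenerate: the runs differ wherever `u > 0`, the cut class `{n > K∕2}` is non-empty
for `K ≥ 1`, infinitely many classes carry weight.
* §1 [folklore] the letters on the datum: `sum_filter_eq_range` · `toy_dev` · `toy_wtA` · `toy_wtB` · `toy_wt_fibre`.
* §2 [folklore ∘ p605203] ★★ `hybridNE7_ageToy` — THE FINE ROAD FIRES: `a 0 = 1`, `a > 0`, `Σ (n+1)·a n < ∞`, `u ≥ 0` antitone with `u j ≤ C·θ^j` (`0 ≤ C`, `0 ≤ θ < 1`), `0 < vol` ⇒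
  `∃ K₀, HybridNE7 l₀ vol (range (K+1)) a (a·e^{−u(K−·)}) (𝟙_{K≥K₀}{n > K∕2}) (𝟙 Σ_{Ioc (K∕2) K} a) 0 0 0 (…)` · ★★ `hybridNE7_ageToy_balaban` — WITH BAŁABAN's ACTIVITY SHAPE
  `a n = exp(−(A′·log(x₀ + b·n))^{2p₀})` for `n ≥ 1` (`0 < A′`, `1 < x₀`, `0 < b`, `1 ≤ p₀`; first moment by p603780's `summable_succ_pow_mul_balabanActivity`) and `u j = C·θ^j`: EVERY
  hypothesis discharged down to the model parameters.
* §4 [folklore ∘ p602850 §6] `toy_logRatio` · ★ `not_coreEdge_ageToy_noCut` — THE CUT IS NECESSARY on the fine road: with NO bad class the bulk and the oldest class of the same datum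
  have an unsummable log-ratio gap `C·(1 − θ^K) → C`, so NO summable `Core` exists at the fine key (`not_coreEdge_of_unsummable_gap` BY NAME) — the zero-cut policy is dead already in the caricature.
* §3 [folklore ∘ p604890] ★ `coreEdge_totals_ageToy` — THE COARSE ROAD FIRES ON THE SAME DATUM at the collapse key `Unit` (no cut): the TOTALS `Σ_{n≤K} a n` and `Σ_{n≤K} a n·e^{−u(K−n)}`
  match modulo constants with a summable remainder (zeroth moment + worst case `R = C`).
READING.  The two roads' hypothesis lists (p604890 §4, p605203 §5–§6) are consistent and non-vacuous together, and the only «physics» in the inhabitant is where it should be: the three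
letters.  Nothing here says the letters hold for Bałaban's densities.

HONEST FRAMING.  A finite TOY (explicit positive sequences) — NOT Bałaban's NE7 ∕ NE7b (NOT PRINTED as two-run statements for d = 4; NODE O's objects), nothing of Bałaban's instantiated or
asserted (the activity FORMULA is print's shape as located by CRIT-1, used as a sequence of numbers); no estimate of the programme is proved.  Count-neutral; N19 ∕ N20 NOT discharged; K3⁷ OPEN,
not claimed; counts UNMOVED (typed 28∕28 · discharged 5∕27, A 5∕28).  Everything below is PROVED (0 `sorry`, 0 named facts, standard axioms); no decl carries a cite tag.  One finite
four-torus programme at fixed ε — NOT ℝ⁴, NOT infinite volume, NOT OS, NOT a mass gap, NOT the Clay problem (R4 closes the conditional finite-𝕋⁴ rung `BalabanLadder.UV` only).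
-/

noncomputable section

open Finset
open scoped BigOperators

namespace Summit.QuantumFields.YangMills.BalabanUVNodes.N19AgeRoadsInhabitant

open Summit.QuantumFields.BalabanUV.T4Continuum.Spine.NE7 (Core)
open Literature.MathematicalPhysics.QuantumFieldTheory.Balaban1983to89
open T4MatchingAssembly (HybridNE7 classVal)
open Summit.QuantumFields.YangMills.BalabanUVNodes.N19AgeCutRoad (hybridNE7_halfAgeCut_eventually)
open Summit.QuantumFields.YangMills.BalabanUVNodes.N19FibreAveragingGain (coreEdge_classVal_of_ageActivity)
open Summit.QuantumFields.YangMills.BalabanUVNodes.N19AgeScaleTransportBudget (summable_succ_pow_mul_balabanActivity)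
open Summit.QuantumFields.YangMills.BalabanUVNodes.N19HybridBeyondTarget (not_coreEdge_of_unsummable_gap)

variable {a u : ℕ → ℝ} {C θ : ℝ}

/-! ## §1 The three letters on the datum [folklore] -/

/-- The age-`n` slice of a sum over `range (K+1)`. [folklore] -/
theorem sum_filter_eq_range (f : ℕ → ℝ) (K n : ℕ) :
    ∑ m ∈ (range (K + 1)).filter (fun m => m = n), f m = if n ≤ K then f n else 0 := by
  rw [Finset.filter_eq']
  by_cases hn : n ≤ K
  · simp [hn, Finset.mem_range.mpr (Nat.lt_succ_of_le hn)]
  · have hn' : n ∉ range (K + 1) := fun h => hn (Nat.le_of_lt_succ (Finset.mem_range.mp h))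
    simp [hn, hn']

/-- BIRTH-SCALE MATCHING on the datum: `|log (a n·e^{−u(K−n)}) − log (a n) − 0| = u (K − n)`. [folklore] -/
theorem toy_dev (hapos : ∀ n, 0 < a n) (hu0 : ∀ j, 0 ≤ u j) (K n : ℕ) :
    |Real.log (a n * Real.exp (-u (K - n))) - Real.log (a n) - 0| ≤ u (K - n) := by
  rw [Real.log_mul (hapos n).ne' (Real.exp_pos _).ne', Real.log_exp]
  have : Real.log (a n) + -u (K - n) - Real.log (a n) - 0 = -u (K - n) := by ring
  rw [this, abs_neg, abs_of_nonneg (hu0 _)]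

/-- ACTIVITY AS WEIGHT FRACTION, run A: the bulk `a 0 = 1` alone outweighs the normalisation. [folklore] -/
theorem toy_wtA (ha0 : a 0 = 1) (hapos : ∀ n, 0 < a n) (K n : ℕ) :
    ∑ m ∈ (range (K + 1)).filter (fun m => m = n), a m ≤ a n * ∑ m ∈ range (K + 1), a m := by
  have h1 : 1 ≤ ∑ m ∈ range (K + 1), a m :=
    ha0 ▸ Finset.single_le_sum (fun m _ => (hapos m).le) (Finset.mem_range.mpr (Nat.succ_pos K))
  rw [sum_filter_eq_range]
  split_ifs
  · exact le_mul_of_one_le_right (hapos n).le h1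
  · exact mul_nonneg (hapos n).le (zero_le_one.trans h1)

/-- ACTIVITY AS WEIGHT FRACTION, run B: uses moreover that `u` is ANTITONE (the bulk's factor `e^{−u K}` dominates `e^{−u(K−n)}`). [folklore] -/
theorem toy_wtB (ha0 : a 0 = 1) (hapos : ∀ n, 0 < a n) (hanti : Antitone u) (K n : ℕ) :
    ∑ m ∈ (range (K + 1)).filter (fun m => m = n), a m * Real.exp (-u (K - m)) ≤
      a n * ∑ m ∈ range (K + 1), a m * Real.exp (-u (K - m)) := by
  have hbulk : Real.exp (-u (K - n)) ≤ ∑ m ∈ range (K + 1), a m * Real.exp (-u (K - m)) := by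
    have h0 : a 0 * Real.exp (-u (K - 0)) ≤ ∑ m ∈ range (K + 1), a m * Real.exp (-u (K - m)) :=
      Finset.single_le_sum (f := fun m => a m * Real.exp (-u (K - m))) (fun m _ => (mul_pos (hapos m) (Real.exp_pos _)).le)
        (Finset.mem_range.mpr (Nat.succ_pos K))
    rw [ha0, one_mul, Nat.sub_zero] at h0
    exact (Real.exp_le_exp.mpr (neg_le_neg (hanti (Nat.sub_le K n)))).trans h0
  rw [sum_filter_eq_range (fun m => a m * Real.exp (-u (K - m)))]
  split_ifs
  · exact mul_le_mul_of_nonneg_left hbulk (hapos n).le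
  · exact mul_nonneg (hapos n).le (Finset.sum_nonneg fun m _ => (mul_pos (hapos m) (Real.exp_pos _)).le)

/-- ACTIVITY AS WEIGHT FRACTION INSIDE A FIBRE whose class map is constant (the collapse key): the filtered class set is all of `range (K+1)`, so `toy_wtA` applies verbatim after
monotonicity in the outer filter. [folklore] -/
theorem toy_wt_fibre {P : ℕ → Prop} [DecidablePred P] (hP : P 0) (ha0 : a 0 = 1) (hapos : ∀ n, 0 < a n) (K n : ℕ) :
    ∑ m ∈ ((range (K + 1)).filter P).filter (fun m => m = n), a m ≤ a n * ∑ m ∈ (range (K + 1)).filter P, a m := by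
  have h1 : 1 ≤ ∑ m ∈ (range (K + 1)).filter P, a m :=
    ha0 ▸ Finset.single_le_sum (fun m _ => (hapos m).le) (Finset.mem_filter.mpr ⟨Finset.mem_range.mpr (Nat.succ_pos K), hP⟩)
  calc ∑ m ∈ ((range (K + 1)).filter P).filter (fun m => m = n), a m ≤ ∑ m ∈ (range (K + 1)).filter (fun m => m = n), a m :=
        Finset.sum_le_sum_of_subset_of_nonneg (Finset.filter_subset_filter _ (Finset.filter_subset _ _)) fun m _ _ => (hapos m).le
    _ ≤ a n * 1 := by
        rw [sum_filter_eq_range, mul_one]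
        split_ifs
        · exact le_rfl
        · exact (hapos n).le
    _ ≤ a n * ∑ m ∈ (range (K + 1)).filter P, a m := mul_le_mul_of_nonneg_left h1 (hapos n).le

/-- Summability of the ZEROTH moment from the first. [folklore] -/
theorem summable_of_summable_succ_mul (hapos : ∀ n, 0 < a n) (ha1 : Summable fun n : ℕ => ((n : ℝ) + 1) * a n) : Summable a :=
  Summable.of_nonneg_of_le (fun n => (hapos n).le) (fun n => le_mul_of_one_le_left (hapos n).le (by have : (0:ℝ) ≤ n := Nat.cast_nonneg n; linarith)) ha1

/-! ## §2 The fine road fires [folklore ∘ p605203] -/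

/-- **★★ THE FINE ROAD FIRES ON THE DATUM** [folklore ∘ `N19AgeCutRoad.hybridNE7_halfAgeCut_eventually`].  Bulk `a 0 = 1`, positive activity with summable FIRST age-moment,
birth-scale letter `u ≥ 0` ANTITONE with `u j ≤ C·θ^j` (`0 ≤ C`, `0 ≤ θ < 1`), `0 < vol` ⇒ from some `K₀` on the two runs `a` and `a·e^{−u(K − ·)}` on `range (K+1)` satisfy the
hybrid binder list with bad class `{n > K∕2}` (the OLD ages), weight the activity tail, zero shells, rate `C·θ^{K − K∕2}∕vol`. -/
theorem hybridNE7_ageToy {l₀ vol : ℝ} (hvol : 0 < vol) (hC : 0 ≤ C) (hθ : 0 ≤ θ) (hθ1 : θ < 1)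
    (hu0 : ∀ j, 0 ≤ u j) (hu : ∀ j, u j ≤ C * θ ^ j) (hanti : Antitone u)
    (ha0 : a 0 = 1) (hapos : ∀ n, 0 < a n) (ha1 : Summable fun n : ℕ => ((n : ℝ) + 1) * a n) :
    ∃ K₀ : ℕ, HybridNE7 l₀ vol (fun K => range (K + 1)) (fun _ _ n => a n) (fun K _ n => a n * Real.exp (-u (K - n)))
      (fun K _ => if K₀ ≤ K then (range (K + 1)).filter (fun n => K / 2 < n) else ∅)
      (Set.indicator {K | K₀ ≤ K} fun K => ∑ n ∈ Ioc (K / 2) K, a n) (fun _ _ _ => 0) (fun _ _ _ => 0) (fun _ => 0)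
      (fun K => if K₀ ≤ K then C * θ ^ (K - K / 2) / vol else C / vol) :=
  hybridNE7_halfAgeCut_eventually (T := fun K => range (K + 1)) (A := fun _ _ n => a n) (B := fun K _ n => a n * Real.exp (-u (K - n))) (age := fun _ _ n => n)
    hvol hC hθ hθ1 hu (fun n => (hapos n).le) ha1 (fun _ _ _ n _ => hapos n) (fun _ _ _ n _ => mul_pos (hapos n) (Real.exp_pos _))
    (fun _ _ _ _ hn => Nat.le_of_lt_succ (Finset.mem_range.mp hn)) (fun K => ⟨0, fun _ _ n _ => toy_dev hapos hu0 K n⟩)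
    (fun K _ _ n => toy_wtA ha0 hapos K n) (fun K _ _ n => toy_wtB ha0 hapos hanti K n)

/-- **★★ … WITH BAŁABAN's ACTIVITY SHAPE AND A GEOMETRIC BIRTH-SCALE LETTER** [folklore ∘ §2 ∘ p603780's `SecondLemma`]: `a n = exp(−(A′·log(x₀ + b·n))^{2p₀})` for `n ≥ 1`, `a 0 = 1`;
`u j = C·θ^j`.  Every hypothesis of the fine road is DISCHARGED down to the model parameters `0 < A′`, `1 < x₀`, `0 < b`, `1 ≤ p₀`, `0 ≤ C`, `0 ≤ θ < 1`, `0 < vol`. -/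
theorem hybridNE7_ageToy_balaban {l₀ vol A' x₀ b : ℝ} {p₀ : ℕ} (hvol : 0 < vol) (hC : 0 ≤ C) (hθ : 0 ≤ θ) (hθ1 : θ < 1)
    (hA' : 0 < A') (hx₀ : 1 < x₀) (hb : 0 < b) (hp₀ : 1 ≤ p₀) :
    ∃ K₀ : ℕ, HybridNE7 l₀ vol (fun K => range (K + 1))
      (fun _ _ n => if n = 0 then (1 : ℝ) else Real.exp (-((A' * Real.log (x₀ + b * n)) ^ (2 * p₀))))
      (fun K _ n => (if n = 0 then (1 : ℝ) else Real.exp (-((A' * Real.log (x₀ + b * n)) ^ (2 * p₀)))) * Real.exp (-(C * θ ^ (K - n))))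
      (fun K _ => if K₀ ≤ K then (range (K + 1)).filter (fun n => K / 2 < n) else ∅)
      (Set.indicator {K | K₀ ≤ K} fun K => ∑ n ∈ Ioc (K / 2) K, if n = 0 then (1 : ℝ) else Real.exp (-((A' * Real.log (x₀ + b * n)) ^ (2 * p₀))))
      (fun _ _ _ => 0) (fun _ _ _ => 0) (fun _ => 0) (fun K => if K₀ ≤ K then C * θ ^ (K - K / 2) / vol else C / vol) := by
  refine hybridNE7_ageToy (a := fun n => if n = 0 then (1 : ℝ) else Real.exp (-((A' * Real.log (x₀ + b * n)) ^ (2 * p₀)))) (u := fun j => C * θ ^ j)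
    hvol hC hθ hθ1 (fun j => by positivity) (fun j => le_rfl) (fun i j hij => mul_le_mul_of_nonneg_left (pow_le_pow_of_le_one hθ hθ1.le hij) hC)
    (by simp) (fun n => by split_ifs <;> positivity) ?_
  -- first age-moment: modify p603780's `SecondLemma` (c = 1) at `n = 0`
  have h := summable_succ_pow_mul_balabanActivity hA' hx₀ hb hp₀ 1
  refine (summable_nat_add_iff 1).mp (((summable_nat_add_iff 1).mpr h).congr fun n => ?_)
  simp [pow_one]

/-! ## §3 The coarse road fires on the same datum, at the collapse key [folklore ∘ p604890] -/

/-- **★ THE COARSE ROAD FIRES (COLLAPSE KEY, NO CUT)** [folklore ∘ `N19FibreAveragingGain.coreEdge_classVal_of_ageActivity`].  Same datum, class map constant `()`: the TOTALS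
`Σ_{n≤K} a n` (run A) and `Σ_{n≤K} a n·e^{−u(K−n)}` (run B) match modulo constants with a SUMMABLE remainder — worst case `R = u 0 ≤ C`, zeroth age-moment, the activity letter inside the
single fibre.  (`classVal (range (K+1)) (fun _ _ => ()) ·` IS the total: Part I's `classVal_collapse`.) -/
theorem coreEdge_totals_ageToy {l₀ vol : ℝ} (hvol : 0 < vol) (hC : 0 ≤ C) (hθ : 0 ≤ θ) (hθ1 : θ < 1)
    (hu0 : ∀ j, 0 ≤ u j) (hu : ∀ j, u j ≤ C * θ ^ j) (hanti : Antitone u)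
    (ha0 : a 0 = 1) (hapos : ∀ n, 0 < a n) (ha1 : Summable fun n : ℕ => ((n : ℝ) + 1) * a n) :
    ∃ δ : ℕ → ℝ, Core l₀ vol (fun _ => ({()} : Finset Unit)) (fun _ _ => ∅)
      (classVal (fun K => range (K + 1)) (fun _ _ => ()) (fun _ _ n => a n))
      (classVal (fun K => range (K + 1)) (fun _ _ => ()) (fun K _ n => a n * Real.exp (-u (K - n)))) δ ∧ Summable δ := by
  have hR : ∀ K n, u (K - n) ≤ C := fun K n => (hanti (Nat.zero_le _)).trans ((hu 0).trans (by simp))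
  exact coreEdge_classVal_of_ageActivity (S := fun K => range (K + 1)) (T := fun _ => ({()} : Finset Unit)) (π := fun _ _ => ()) (Bad := fun _ _ => ∅)
    (p := fun _ _ n => a n) (q := fun K _ n => a n * Real.exp (-u (K - n))) (age := fun _ _ n => n) (R := C)
    hvol hC hθ hθ1 hu0 hu (fun n => (hapos n).le) (summable_of_summable_succ_mul hapos ha1)
    (fun _ _ _ _ _ n _ => hapos n) (fun _ _ _ _ _ n _ => mul_pos (hapos n) (Real.exp_pos _))
    (fun _ _ _ _ _ _ hn => Nat.le_of_lt_succ (Finset.mem_range.mp (Finset.mem_filter.mp hn).1))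
    (fun K => ⟨0, fun _ _ _ _ n _ => ⟨toy_dev hapos hu0 K n, (toy_dev hapos hu0 K n).trans (hR K n)⟩⟩)
    (fun K _ _ τ _ n => toy_wt_fibre (P := fun s => ((fun (_ : ℕ) (_ : ℕ) => ()) K s) = τ) (Subsingleton.elim _ _) ha0 hapos K n)


/-! ## §4 Without the cut, the same datum admits NO summable `Core` at the fine key [folklore ∘ p602850 §6] -/

/-- The log-ratio of the datum at class `n`: `log (a n·e^{x}) − log (a n) = x`. [folklore] -/
theorem toy_logRatio (hapos : ∀ n, 0 < a n) (x : ℝ) (n : ℕ) : Real.log (a n * Real.exp x) - Real.log (a n) = x := by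
  rw [Real.log_mul (hapos n).ne' (Real.exp_pos _).ne', Real.log_exp]; ring

/-- **★ THE CUT IS NECESSARY ON THE FINE ROAD (in the datum)** [folklore ∘ `N19HybridBeyondTarget.not_coreEdge_of_unsummable_gap`].  With `u j = C·θ^j`, `0 < C`, `0 ≤ θ < 1`, and NO
bad class, the classes `0` (bulk, deviation `C·θ^K → 0`) and `K` (oldest component, deviation `C`) of the datum are both GOOD and their log-ratio gap `C·(1 − θ^K) → C` is NOT summable —
so `¬ ∃ δ, Core … ∅ … δ ∧ Summable δ` at the fine key: the zero-cut policy is dead for the old-large-field channel even in the caricature, while §2 (half-age cut) and §3 (coarse key)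
succeed on the same numbers. -/
theorem not_coreEdge_ageToy_noCut {l₀ vol : ℝ} (hl₀ : 0 ≤ l₀) (hC : 0 < C) (hθ : 0 ≤ θ) (hθ1 : θ < 1) (hapos : ∀ n, 0 < a n) :
    ¬ ∃ δ : ℕ → ℝ, Core l₀ vol (fun K => range (K + 1)) (fun _ _ => (∅ : Finset ℕ)) (fun _ _ n => a n)
      (fun K _ n => a n * Real.exp (-(C * θ ^ (K - n)))) δ ∧ Summable δ := by
  have hg0 : ∀ K : ℕ, 0 ≤ C * (1 - θ ^ K) := fun K => mul_nonneg hC.le (sub_nonneg.mpr (pow_le_one₀ hθ hθ1.le))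
  have hg : ¬ Summable fun K : ℕ => C * (1 - θ ^ K) := by
    intro h
    have h1 : Filter.Tendsto (fun K : ℕ => C * (1 - θ ^ K)) Filter.atTop (nhds (C * (1 - 0))) :=
      ((tendsto_pow_atTop_nhds_zero_of_lt_one hθ hθ1).const_sub 1).const_mul C
    have h2 := tendsto_nhds_unique h.tendsto_atTop_zero h1
    have : C = 0 := by simpa using h2.symm
    exact hC.ne' this
  refine not_coreEdge_of_unsummable_gap hg0 hg fun K => ⟨0, by rw [abs_zero]; exact hl₀, 0, ?_, K, ?_, hapos 0, hapos K, ?_⟩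
  · simp
  · simp
  · rw [toy_logRatio hapos, toy_logRatio hapos, Nat.sub_zero, Nat.sub_self, pow_zero, mul_one]
    linarith

end Summit.QuantumFields.YangMills.BalabanUVNodes.N19AgeRoadsInhabitant

end
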